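import Summits.NavierStokesRegularity.NavierStokesRegularity.Theorems.FilamentSkeletonRssCoreLinearInvertibilityOddAttenuationWeighted
import Literature.Analysis.FluidPDE.BiotSavart2DModeTwo

/-!
# Tools F for stub `stub_oddAttenuation` of crux `CoreLinearInvertibility`
# (stmt-NavierStokesRegularity-17973), line `Sketch`: the rotation (angular-momentum) estimate

The conjugated local operator `H̃u = Δu + λ x₀∂₀u − (κ|x|² + δx₀²) u + ((1+λ)/2) u − R Ω ∂_θu`
paired with the angular-momentum multiplier `∂_θu = Du[x^⊥]`, for `u ∈ C²` of Gaussian decay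
with two derivatives:

* (R) `∫ (H̃u) ∂_θu = λ ∫ (x₀∂₀u)(∂_θu) − δ ∫ x₀x₁u² − R ∫ Ω (∂_θu)²`
  (`⟨Δu, ∂_θu⟩ = 0`, `∫ u ∂_θu = 0`, `∫ V u ∂_θu = −½∫(∂_θV)u² = δ∫x₀x₁u²`);
* (R′) `R ∫ Ω (∂_θu)² ≤ (∫(H̃u)²)^{1/2} (∫|x|²|∇u|²)^{1/2} + λ ∫|x|²|∇u|² + δ ∫|x|²u²`
  (`λ, δ ≥ 0`; `(∂_θu)² ≤ |x|²|∇u|²`, `|x₀∂₀u ∂_θu| ≤ |x|²|∇u|²`, `|x₀x₁| ≤ |x|²` — the tree's `abs_mul_apply_le_norm_sq`).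

This is the only place where the rotation enters: it controls `Θ = ∫ Ω (∂_θu)²` by `O(1/R)`.
-/

set_option linter.dupNamespace false

noncomputable section

namespace Summit.NavierStokesRegularity.NavierStokesRegularity.Theorems

open MeasureTheory Filter Topology Set
open Literature.Analysis.FluidPDE
open Summit.AnomalousDissipation.AnomalousDissipation.Theorems.MarginalStabilityChainStretchedVortexRows
open scoped InnerProductSpace Laplacian ContDiff

/-! ### The confining potential `V = κ|x|² + δx₀²` -/

/-- `V = κ|x|² + δx₀²` is `C¹`. [folklore] -/
theorem contDiff_confiningPotential (κ δ : ℝ) {n : WithTop ℕ∞} :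
    ContDiff ℝ n fun x : EuclideanSpace ℝ (Fin 2) => κ * ‖x‖ ^ 2 + δ * x 0 ^ 2 :=
  (contDiff_const.mul (contDiff_norm_sq ℝ)).add (contDiff_const.mul ((contDiff_coord 0).pow 2))

/-- `∂ᵥV(x) = 2κ⟪x, v⟫ + 2δ x₀ v₀`. [folklore] -/
theorem fderiv_confiningPotential_apply (κ δ : ℝ) (x v : EuclideanSpace ℝ (Fin 2)) :
    fderiv ℝ (fun y : EuclideanSpace ℝ (Fin 2) => κ * ‖y‖ ^ 2 + δ * y 0 ^ 2) x v =
      κ * (2 * ⟪x, v⟫_ℝ) + δ * (2 * x 0 * v 0) := by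
  have h1 : HasFDerivAt (fun y : EuclideanSpace ℝ (Fin 2) => ‖y‖ ^ 2) (2 • innerSL ℝ x) x :=
    (hasStrictFDerivAt_norm_sq x).hasFDerivAt
  have h2 : HasFDerivAt (fun y : EuclideanSpace ℝ (Fin 2) => y 0)
      (EuclideanSpace.proj 0 : EuclideanSpace ℝ (Fin 2) →L[ℝ] ℝ) x :=
    (EuclideanSpace.proj 0 : EuclideanSpace ℝ (Fin 2) →L[ℝ] ℝ).hasFDerivAt
  have h3 : HasFDerivAt (fun y : EuclideanSpace ℝ (Fin 2) => y 0 ^ 2)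
      ((2 * x 0) • (EuclideanSpace.proj 0 : EuclideanSpace ℝ (Fin 2) →L[ℝ] ℝ)) x := by
    simpa using h2.pow 2
  rw [((h1.const_mul κ).fun_add (h3.const_mul δ)).fderiv]
  simp only [add_apply, FunLike.coe_smul, Pi.smul_apply, smul_eq_mul]
  simp only [coe_innerSL_apply, nsmul_eq_mul, Nat.cast_ofNat, Fin.isValue, PiLp.proj_apply]

/-- `V` is polynomially bounded. [folklore] -/
theorem polyBound_confiningPotential (κ δ : ℝ) :
    ∃ (C : ℝ) (N : ℕ), ∀ x : EuclideanSpace ℝ (Fin 2), |κ * ‖x‖ ^ 2 + δ * x 0 ^ 2| ≤ C * (1 + ‖x‖) ^ N :=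
  polyBound_of_le_add
    (polyBound_of_le_mul (polyBound_const κ) polyBound_norm_sq (H := fun x => κ * ‖x‖ ^ 2)
      fun x => (abs_mul _ _).le)
    (polyBound_of_le_mul (polyBound_const δ) (polyBound_of_le_mul (polyBound_coord 0) (polyBound_coord 0)
      (H := fun x => x 0 ^ 2) fun x => by rw [sq, abs_mul]) (H := fun x => δ * x 0 ^ 2)
      fun x => (abs_mul _ _).le)
    fun x => abs_add_le _ _

/-- `∂ᵥV` is polynomially bounded. [folklore] -/
theorem polyBound_fderiv_confiningPotential (κ δ : ℝ) (v : EuclideanSpace ℝ (Fin 2)) :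
    ∃ (C : ℝ) (N : ℕ), ∀ x : EuclideanSpace ℝ (Fin 2),
      |fderiv ℝ (fun y : EuclideanSpace ℝ (Fin 2) => κ * ‖y‖ ^ 2 + δ * y 0 ^ 2) x v| ≤ C * (1 + ‖x‖) ^ N := by
  refine ⟨2 * |κ| * ‖v‖ + 2 * |δ| * ‖v‖, 1, fun x => ?_⟩
  rw [fderiv_confiningPotential_apply, pow_one]
  have hx0 : |x 0| ≤ ‖x‖ := abs_coord_le_norm_fin_two x 0
  have hv0 : |v 0| ≤ ‖v‖ := abs_coord_le_norm_fin_two v 0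
  have hi : |⟪x, v⟫_ℝ| ≤ ‖x‖ * ‖v‖ := abs_real_inner_le_norm x v
  calc |κ * (2 * ⟪x, v⟫_ℝ) + δ * (2 * x 0 * v 0)|
      ≤ |κ * (2 * ⟪x, v⟫_ℝ)| + |δ * (2 * x 0 * v 0)| := abs_add_le _ _
    _ = 2 * |κ| * |⟪x, v⟫_ℝ| + 2 * |δ| * (|x 0| * |v 0|) := by
        simp only [abs_mul, abs_two]; ring
    _ ≤ 2 * |κ| * (‖x‖ * ‖v‖) + 2 * |δ| * (‖x‖ * ‖v‖) := by
        gcongr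
    _ ≤ (2 * |κ| * ‖v‖ + 2 * |δ| * ‖v‖) * (1 + ‖x‖) := by
        nlinarith [abs_nonneg κ, abs_nonneg δ, norm_nonneg v, norm_nonneg x]

/-! ### Pointwise angular bounds -/

/-- `(∂_θu)² ≤ |x|² |∇u|²`. [folklore] -/
theorem sq_fderiv_perp_le_norm_sq_mul (u : EuclideanSpace ℝ (Fin 2) → ℝ) (x : EuclideanSpace ℝ (Fin 2)) :
    fderiv ℝ u x (perp x) ^ 2 ≤ ‖x‖ ^ 2 * (fderiv ℝ u x (EuclideanSpace.single 0 1) ^ 2 +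
      fderiv ℝ u x (EuclideanSpace.single 1 1) ^ 2) := by
  rw [fderiv_apply_perp, EuclideanSpace.real_norm_sq_eq, Fin.sum_univ_two]
  nlinarith [sq_nonneg (x 0 * fderiv ℝ u x (EuclideanSpace.single 0 1) +
    x 1 * fderiv ℝ u x (EuclideanSpace.single 1 1))]

/-- `|x₀∂₀u · ∂_θu| ≤ |x|² |∇u|²`. [folklore] -/
theorem abs_coord_fderiv_mul_fderiv_perp_le (u : EuclideanSpace ℝ (Fin 2) → ℝ) (x : EuclideanSpace ℝ (Fin 2)) :
    |x 0 * fderiv ℝ u x (EuclideanSpace.single 0 1) * fderiv ℝ u x (perp x)| ≤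
      ‖x‖ ^ 2 * (fderiv ℝ u x (EuclideanSpace.single 0 1) ^ 2 + fderiv ℝ u x (EuclideanSpace.single 1 1) ^ 2) := by
  have ht := sq_fderiv_perp_le_norm_sq_mul u x
  set s := x 0 * fderiv ℝ u x (EuclideanSpace.single 0 1) with hs
  set t := fderiv ℝ u x (perp x) with htt
  have h1 : |s * t| ≤ (s ^ 2 + t ^ 2) / 2 := by
    rw [abs_mul]
    nlinarith [sq_abs s, sq_abs t, sq_nonneg (|s| - |t|), abs_nonneg s, abs_nonneg t]
  have h2 : s ^ 2 ≤ ‖x‖ ^ 2 * (fderiv ℝ u x (EuclideanSpace.single 0 1) ^ 2 +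
      fderiv ℝ u x (EuclideanSpace.single 1 1) ^ 2) := by
    rw [hs, EuclideanSpace.real_norm_sq_eq, Fin.sum_univ_two]
    nlinarith [sq_nonneg (x 0 * fderiv ℝ u x (EuclideanSpace.single 1 1)),
      sq_nonneg (x 1 * fderiv ℝ u x (EuclideanSpace.single 0 1)),
      sq_nonneg (x 1 * fderiv ℝ u x (EuclideanSpace.single 1 1))]
  linarith

section Rotation

variable {u : EuclideanSpace ℝ (Fin 2) → ℝ} (hu : ContDiff ℝ 2 u)
  (hB : ∃ (C : ℝ) (N : ℕ), ∀ x, |u x| ≤ C * (1 + ‖x‖) ^ N * Real.exp (-(1 / 8 * ‖x‖ ^ 2)) ∧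
      ‖fderiv ℝ u x‖ ≤ C * (1 + ‖x‖) ^ N * Real.exp (-(1 / 8 * ‖x‖ ^ 2)) ∧
      ‖fderiv ℝ (fderiv ℝ u) x‖ ≤ C * (1 + ‖x‖) ^ N * Real.exp (-(1 / 8 * ‖x‖ ^ 2)))
  {lam κ δ R : ℝ} {f : EuclideanSpace ℝ (Fin 2) → ℝ}
  (hf : ∀ x, f x = Δ u x + lam * x 0 * fderiv ℝ u x (EuclideanSpace.single 0 1) -
      (κ * ‖x‖ ^ 2 + δ * x 0 ^ 2) * u x + (1 + lam) / 2 * u x -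
      R * ((8 * Real.pi)⁻¹ * burgersPhi (‖x‖ ^ 2 / 4) * fderiv ℝ u x (perp x)))
  (hfc : Continuous f)
  (hfB : ∃ (C : ℝ) (N : ℕ), ∀ x, |f x| ≤ C * (1 + ‖x‖) ^ N * Real.exp (-(1 / 8 * ‖x‖ ^ 2)))

include hu hB in
/-- `∫ V u ∂_θu = δ ∫ x₀x₁ u²` (`∂_θV = −2δx₀x₁`). [folklore] -/
theorem integral_confiningPotential_mul_mul_fderiv_perp_eq :
    ∫ x, (κ * ‖x‖ ^ 2 + δ * x 0 ^ 2) * u x * fderiv ℝ u x (perp x) = δ * ∫ x, x 0 * x 1 * u x ^ 2 := by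
  rw [integral_mul_mul_fderiv_perp_eq_of_gaussDecay hu hB (contDiff_confiningPotential κ δ)
    (polyBound_confiningPotential κ δ) (polyBound_fderiv_confiningPotential κ δ), ← integral_const_mul,
    ← integral_const_mul]
  refine integral_congr_ae (Eventually.of_forall fun x => ?_)
  simp only [fderiv_confiningPotential_apply, inner_self_perp, perp_apply_zero]
  ring

include hu hB in
/-- `∫ u ∂_θu = 0`. [folklore] -/
theorem integral_self_mul_fderiv_perp_eq_zero : ∫ x, u x * fderiv ℝ u x (perp x) = 0 := by
  have h := integral_mul_mul_fderiv_perp_eq_of_gaussDecay hu hB (m := fun _ => (1 : ℝ)) contDiff_const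
    (polyBound_const 1) (fun v => ⟨0, 0, fun x => by simp⟩)
  simp only [one_mul, fderiv_fun_const, Pi.zero_apply, zero_apply, zero_mul, integral_zero, mul_zero] at h
  exact h

include hu hB hf in
/-- **(R) The rotation identity**: `∫ (H̃u) ∂_θu = λ ∫ (x₀∂₀u)(∂_θu) − δ ∫ x₀x₁u² − R ∫ Ω (∂_θu)²`. [folklore] -/
theorem oddAttenuation_rotation_identity :
    ∫ x, f x * fderiv ℝ u x (perp x) =
      lam * (∫ x, x 0 * fderiv ℝ u x (EuclideanSpace.single 0 1) * fderiv ℝ u x (perp x)) -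
      δ * (∫ x, x 0 * x 1 * u x ^ 2) -
      R * ∫ x, (8 * Real.pi)⁻¹ * burgersPhi (‖x‖ ^ 2 / 4) * fderiv ℝ u x (perp x) ^ 2 := by
  have hU := gaussDecay_self hB
  have hUθ := gaussDecay_fderiv_perp hB
  have hcθ := continuous_fderiv_perp_of_contDiff_two hu
  have e1 : ∀ x, f x * fderiv ℝ u x (perp x) =
      fderiv ℝ u x (perp x) * Δ u x +
      lam * (x 0 * fderiv ℝ u x (EuclideanSpace.single 0 1) * fderiv ℝ u x (perp x)) -
      (κ * ‖x‖ ^ 2 + δ * x 0 ^ 2) * u x * fderiv ℝ u x (perp x) +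
      (1 + lam) / 2 * (u x * fderiv ℝ u x (perp x)) -
      R * ((8 * Real.pi)⁻¹ * burgersPhi (‖x‖ ^ 2 / 4) * fderiv ℝ u x (perp x) ^ 2) := by
    intro x; rw [hf]; ring
  have hlap : ∀ x, Δ u x = fderiv ℝ (fderiv ℝ u) x (EuclideanSpace.single 0 1) (EuclideanSpace.single 0 1) +
      fderiv ℝ (fderiv ℝ u) x (EuclideanSpace.single 1 1) (EuclideanSpace.single 1 1) := fun x => by
    rw [laplacian_eq_sum_fderiv_fderiv (EuclideanSpace.basisFun (Fin 2) ℝ) hu x, Fin.sum_univ_two,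
      EuclideanSpace.basisFun_apply, EuclideanSpace.basisFun_apply, fderiv_partialDeriv_apply hu,
      fderiv_partialDeriv_apply hu]
  have iA : Integrable fun x => fderiv ℝ u x (perp x) * Δ u x := by
    have e : (fun x => fderiv ℝ u x (perp x) * Δ u x) = fun x =>
        fderiv ℝ u x (perp x) * fderiv ℝ (fderiv ℝ u) x (EuclideanSpace.single 0 1) (EuclideanSpace.single 0 1) +
        fderiv ℝ u x (perp x) * fderiv ℝ (fderiv ℝ u) x (EuclideanSpace.single 1 1) (EuclideanSpace.single 1 1) := by
      funext x; rw [hlap]; ring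
    rw [e]
    refine Integrable.add ?_ ?_ <;>
      exact integrable_of_gaussDecay (by norm_num)
        (hcθ.mul (continuous_fderiv_fderiv_apply_of_contDiff_two hu _ _))
        (gaussDecay_of_le_poly_mul_mul (polyBound_const 1) hUθ (gaussDecay_fderiv_fderiv_apply hB _ _)
          fun x => by rw [abs_mul, abs_one, one_mul])
  have iB : Integrable fun x => x 0 * fderiv ℝ u x (EuclideanSpace.single 0 1) * fderiv ℝ u x (perp x) :=
    integrable_of_gaussDecay (by norm_num)
      (((contDiff_coord 0 (n := 0)).continuous.mul (continuous_fderiv_apply_of_contDiff_two hu _)).mul hcθ)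
      (gaussDecay_of_le_poly_mul_mul (polyBound_coord 0) (gaussDecay_fderiv_apply hB _) hUθ
        fun x => by rw [abs_mul, abs_mul])
  have iC : Integrable fun x => (κ * ‖x‖ ^ 2 + δ * x 0 ^ 2) * u x * fderiv ℝ u x (perp x) :=
    integrable_of_gaussDecay (by norm_num)
      (((contDiff_confiningPotential κ δ (n := 0)).continuous.mul hu.continuous).mul hcθ)
      (gaussDecay_of_le_poly_mul_mul (polyBound_confiningPotential κ δ) hU hUθ fun x => by rw [abs_mul, abs_mul])
  have iD : Integrable fun x => u x * fderiv ℝ u x (perp x) :=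
    integrable_of_gaussDecay (by norm_num) (hu.continuous.mul hcθ)
      (gaussDecay_of_le_poly_mul_mul (polyBound_const 1) hU hUθ fun x => by rw [abs_mul, abs_one, one_mul])
  have iE : Integrable fun x => (8 * Real.pi)⁻¹ * burgersPhi (‖x‖ ^ 2 / 4) * fderiv ℝ u x (perp x) ^ 2 :=
    integrable_of_gaussDecay (by norm_num) ((contDiff_omega (n := 0)).continuous.mul (hcθ.pow 2))
      (gaussDecay_of_le_poly_mul_mul polyBound_omega hUθ hUθ fun x => abs_mul_sq_le _ _)
  have iB' : Integrable fun x =>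
      lam * (x 0 * fderiv ℝ u x (EuclideanSpace.single 0 1) * fderiv ℝ u x (perp x)) := iB.const_mul lam
  have iD' : Integrable fun x => (1 + lam) / 2 * (u x * fderiv ℝ u x (perp x)) := iD.const_mul _
  have iE' : Integrable fun x =>
      R * ((8 * Real.pi)⁻¹ * burgersPhi (‖x‖ ^ 2 / 4) * fderiv ℝ u x (perp x) ^ 2) := iE.const_mul R
  have i2 : Integrable fun x => fderiv ℝ u x (perp x) * Δ u x +
      lam * (x 0 * fderiv ℝ u x (EuclideanSpace.single 0 1) * fderiv ℝ u x (perp x)) := iA.add iB'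
  have i3 : Integrable fun x => fderiv ℝ u x (perp x) * Δ u x +
      lam * (x 0 * fderiv ℝ u x (EuclideanSpace.single 0 1) * fderiv ℝ u x (perp x)) -
      (κ * ‖x‖ ^ 2 + δ * x 0 ^ 2) * u x * fderiv ℝ u x (perp x) := i2.sub iC
  have i4 : Integrable fun x => fderiv ℝ u x (perp x) * Δ u x +
      lam * (x 0 * fderiv ℝ u x (EuclideanSpace.single 0 1) * fderiv ℝ u x (perp x)) -
      (κ * ‖x‖ ^ 2 + δ * x 0 ^ 2) * u x * fderiv ℝ u x (perp x) +
      (1 + lam) / 2 * (u x * fderiv ℝ u x (perp x)) := i3.add iD'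
  simp_rw [e1]
  rw [integral_sub i4 iE', integral_add i3 iD', integral_sub i2 iC, integral_add iA iB',
    integral_const_mul, integral_const_mul, integral_const_mul,
    integral_fderiv_perp_mul_laplacian_eq_zero hu hB, integral_confiningPotential_mul_mul_fderiv_perp_eq hu hB,
    integral_self_mul_fderiv_perp_eq_zero hu hB]
  ring

include hu hB hf hfc hfB in
/-- **(R′) The rotation estimate**:
`R ∫ Ω (∂_θu)² ≤ (∫(H̃u)²)^{1/2} (∫|x|²|∇u|²)^{1/2} + λ ∫|x|²|∇u|² + δ ∫|x|²u²` (`λ, δ ≥ 0`). [folklore] -/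
theorem oddAttenuation_rotation_estimate (hlam : 0 ≤ lam) (hδ : 0 ≤ δ) :
    R * ∫ x, (8 * Real.pi)⁻¹ * burgersPhi (‖x‖ ^ 2 / 4) * fderiv ℝ u x (perp x) ^ 2 ≤
      Real.sqrt (∫ x, f x ^ 2) * Real.sqrt (∫ x, ‖x‖ ^ 2 * (fderiv ℝ u x (EuclideanSpace.single 0 1) ^ 2 +
        fderiv ℝ u x (EuclideanSpace.single 1 1) ^ 2)) +
      lam * (∫ x, ‖x‖ ^ 2 * (fderiv ℝ u x (EuclideanSpace.single 0 1) ^ 2 +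
        fderiv ℝ u x (EuclideanSpace.single 1 1) ^ 2)) + δ * ∫ x, ‖x‖ ^ 2 * u x ^ 2 := by
  have hid := oddAttenuation_rotation_identity hu hB hf
  have hU := gaussDecay_self hB
  have hUθ := gaussDecay_fderiv_perp hB
  have hcθ := continuous_fderiv_perp_of_contDiff_two hu
  have hU0 := gaussDecay_fderiv_apply hB (EuclideanSpace.single 0 1)
  have hU1 := gaussDecay_fderiv_apply hB (EuclideanSpace.single 1 1)
  -- integrability
  have if2 : Integrable fun x => f x ^ 2 :=
    integrable_of_gaussDecay (by norm_num) (hfc.pow 2)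
      (gaussDecay_of_le_poly_mul_mul (polyBound_const 1) hfB hfB fun x => abs_sq_le_one_mul _)
  have iθ2 : Integrable fun x => fderiv ℝ u x (perp x) ^ 2 :=
    integrable_of_gaussDecay (by norm_num) (hcθ.pow 2)
      (gaussDecay_of_le_poly_mul_mul (polyBound_const 1) hUθ hUθ fun x => abs_sq_le_one_mul _)
  have ifθ : Integrable fun x => f x * fderiv ℝ u x (perp x) :=
    integrable_of_gaussDecay (by norm_num) (hfc.mul hcθ)
      (gaussDecay_of_le_poly_mul_mul (polyBound_const 1) hfB hUθ fun x => by rw [abs_mul, abs_one, one_mul])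
  have iW : Integrable fun x => ‖x‖ ^ 2 * (fderiv ℝ u x (EuclideanSpace.single 0 1) ^ 2 +
      fderiv ℝ u x (EuclideanSpace.single 1 1) ^ 2) :=
    integrable_of_gaussDecay (by norm_num)
      ((continuous_norm.pow 2).mul ((continuous_fderiv_apply_of_contDiff_two hu _).pow 2 |>.add
        ((continuous_fderiv_apply_of_contDiff_two hu _).pow 2)))
      (gaussDecay_of_le_add
        (gaussDecay_of_le_poly_mul_mul polyBound_norm_sq hU0 hU0
          (H := fun x => ‖x‖ ^ 2 * fderiv ℝ u x (EuclideanSpace.single 0 1) ^ 2) fun x => abs_mul_sq_le _ _)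
        (gaussDecay_of_le_poly_mul_mul polyBound_norm_sq hU1 hU1
          (H := fun x => ‖x‖ ^ 2 * fderiv ℝ u x (EuclideanSpace.single 1 1) ^ 2) fun x => abs_mul_sq_le _ _)
        fun x => by rw [mul_add]; exact abs_add_le _ _)
  have iB : Integrable fun x => x 0 * fderiv ℝ u x (EuclideanSpace.single 0 1) * fderiv ℝ u x (perp x) :=
    integrable_of_gaussDecay (by norm_num)
      (((contDiff_coord 0 (n := 0)).continuous.mul (continuous_fderiv_apply_of_contDiff_two hu _)).mul hcθ)
      (gaussDecay_of_le_poly_mul_mul (polyBound_coord 0) hU0 hUθ fun x => by rw [abs_mul, abs_mul])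
  have iX : Integrable fun x => ‖x‖ ^ 2 * u x ^ 2 :=
    integrable_of_gaussDecay (by norm_num) ((continuous_norm.pow 2).mul (hu.continuous.pow 2))
      (gaussDecay_of_le_poly_mul_mul polyBound_norm_sq hU hU fun x => abs_mul_sq_le _ _)
  have i01 : Integrable fun x => x 0 * x 1 * u x ^ 2 :=
    integrable_of_gaussDecay (by norm_num)
      ((((contDiff_coord 0 (n := 0)).continuous.mul (contDiff_coord 1 (n := 0)).continuous)).mul
        (hu.continuous.pow 2))
      (gaussDecay_of_le_poly_mul_mul (polyBound_of_le_mul (polyBound_coord 0) (polyBound_coord 1)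
        fun x => (abs_mul _ _).le) hU hU fun x => abs_mul_sq_le _ _)
  -- (a) Cauchy–Schwarz and `∫ (∂_θu)² ≤ ∫ |x|²|∇u|²`
  have hCS := abs_integral_mul_le_sqrt_mul_sqrt if2 iθ2 ifθ
  have hθW : ∫ x, fderiv ℝ u x (perp x) ^ 2 ≤ ∫ x, ‖x‖ ^ 2 * (fderiv ℝ u x (EuclideanSpace.single 0 1) ^ 2 +
      fderiv ℝ u x (EuclideanSpace.single 1 1) ^ 2) :=
    integral_mono iθ2 iW fun x => sq_fderiv_perp_le_norm_sq_mul u x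
  have ha : -(∫ x, f x * fderiv ℝ u x (perp x)) ≤
      Real.sqrt (∫ x, f x ^ 2) * Real.sqrt (∫ x, ‖x‖ ^ 2 * (fderiv ℝ u x (EuclideanSpace.single 0 1) ^ 2 +
        fderiv ℝ u x (EuclideanSpace.single 1 1) ^ 2)) :=
    ((neg_le_abs _).trans hCS).trans
      (mul_le_mul_of_nonneg_left (Real.sqrt_le_sqrt hθW) (Real.sqrt_nonneg _))
  -- (b) the strain pairing
  have hb : |∫ x, x 0 * fderiv ℝ u x (EuclideanSpace.single 0 1) * fderiv ℝ u x (perp x)| ≤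
      ∫ x, ‖x‖ ^ 2 * (fderiv ℝ u x (EuclideanSpace.single 0 1) ^ 2 + fderiv ℝ u x (EuclideanSpace.single 1 1) ^ 2) :=
    (abs_integral_le_integral_abs (μ := volume)).trans
      (integral_mono iB.abs iW fun x => abs_coord_fderiv_mul_fderiv_perp_le u x)
  -- (c) the potential commutator
  have hc : |∫ x, x 0 * x 1 * u x ^ 2| ≤ ∫ x, ‖x‖ ^ 2 * u x ^ 2 :=
    (abs_integral_le_integral_abs (μ := volume)).trans
      (integral_mono i01.abs iX fun x => by
        change |x 0 * x 1 * u x ^ 2| ≤ ‖x‖ ^ 2 * u x ^ 2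
        rw [abs_mul, abs_of_nonneg (sq_nonneg (u x))]
        exact mul_le_mul_of_nonneg_right (abs_mul_apply_le_norm_sq x) (sq_nonneg _))
  have hb' := (le_abs_self _).trans hb
  have hc' := (neg_le_abs _).trans hc
  nlinarith [mul_le_mul_of_nonneg_left hb' hlam, mul_le_mul_of_nonneg_left hc' hδ]

end Rotation

/-- Registered tools stub of crux stmt-NavierStokesRegularity-17973 (`stub_oddAttenuationToolsF`):
the rotation identity and the rotation estimate of the conjugated local operator. [folklore] -/
theorem stub_oddAttenuationToolsF :
    ∀ (u : EuclideanSpace ℝ (Fin 2) → ℝ), ContDiff ℝ 2 u →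
      (∃ (C : ℝ) (N : ℕ), ∀ x, |u x| ≤ C * (1 + ‖x‖) ^ N * Real.exp (-(1 / 8 * ‖x‖ ^ 2)) ∧
        ‖fderiv ℝ u x‖ ≤ C * (1 + ‖x‖) ^ N * Real.exp (-(1 / 8 * ‖x‖ ^ 2)) ∧
        ‖fderiv ℝ (fderiv ℝ u) x‖ ≤ C * (1 + ‖x‖) ^ N * Real.exp (-(1 / 8 * ‖x‖ ^ 2))) →
      ∀ (lam κ δ R : ℝ) (f : EuclideanSpace ℝ (Fin 2) → ℝ),
      (∀ x, f x = Δ u x + lam * x 0 * fderiv ℝ u x (EuclideanSpace.single 0 1) -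
        (κ * ‖x‖ ^ 2 + δ * x 0 ^ 2) * u x + (1 + lam) / 2 * u x -
        R * ((8 * Real.pi)⁻¹ * burgersPhi (‖x‖ ^ 2 / 4) * fderiv ℝ u x (perp x))) →
      (∫ x, f x * fderiv ℝ u x (perp x) =
        lam * (∫ x, x 0 * fderiv ℝ u x (EuclideanSpace.single 0 1) * fderiv ℝ u x (perp x)) -
        δ * (∫ x, x 0 * x 1 * u x ^ 2) -
        R * ∫ x, (8 * Real.pi)⁻¹ * burgersPhi (‖x‖ ^ 2 / 4) * fderiv ℝ u x (perp x) ^ 2) ∧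
      (Continuous f →
        (∃ (C : ℝ) (N : ℕ), ∀ x, |f x| ≤ C * (1 + ‖x‖) ^ N * Real.exp (-(1 / 8 * ‖x‖ ^ 2))) →
        0 ≤ lam → 0 ≤ δ →
        R * ∫ x, (8 * Real.pi)⁻¹ * burgersPhi (‖x‖ ^ 2 / 4) * fderiv ℝ u x (perp x) ^ 2 ≤
          Real.sqrt (∫ x, f x ^ 2) *
            Real.sqrt (∫ x, ‖x‖ ^ 2 * (fderiv ℝ u x (EuclideanSpace.single 0 1) ^ 2 +
              fderiv ℝ u x (EuclideanSpace.single 1 1) ^ 2)) +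
          lam * (∫ x, ‖x‖ ^ 2 * (fderiv ℝ u x (EuclideanSpace.single 0 1) ^ 2 +
            fderiv ℝ u x (EuclideanSpace.single 1 1) ^ 2)) + δ * ∫ x, ‖x‖ ^ 2 * u x ^ 2) :=
  fun _ hu hB _ _ _ _ _ hf =>
    ⟨oddAttenuation_rotation_identity hu hB hf,
      fun hfc hfB hlam hδ => oddAttenuation_rotation_estimate hu hB hf hfc hfB hlam hδ⟩

end Summit.NavierStokesRegularity.NavierStokesRegularity.Theorems
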